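import Literature.Barriers.RiemannHypothesis.TuranPartialSumsCheck
import Literature.Barriers.RiemannHypothesis.TuranPartialSumsCriterion
import HarnessLib

/-!
# Sections of `ζ` beyond `σ = 1`: the objects of the checker's soundness proof

Barrier catalogue `Literature/Barriers/RiemannHypothesis/`, companion of `TuranPartialSums.lean`
(the kernel-certificate part of the plan to prove `TuranPartialSums`). This file only DEFINES the
(noncomputable, `Prop`- or `ℂ`-valued) objects in terms of which the soundness of the checker
`TuranPartialSumsCheck.check` is stated and proved in `TuranPartialSumsCheckArith/Strip/Inv/Step/
Sound.lean`; nothing is asserted.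

* `Valid es` — what `validEntries es = true` means: the keys `p` are strictly increasing primes and
  each entry `(p, x, y, d)` has `d > 0`, `x² + y² = d²`;
* `phaseOf es p = (x + iy)/d` — the phase of the key `p` (`1` off the keys), i.e. the `ω` of the
  criterion `exists_zero_of_criterion`; `keySet es` — the set `S` of keys;
* `keyPow es m = ∏ p^{v_p(m)}`, `phasePow es m = ∏ (x_p + iy_p)^{v_p(m)}`,
  `denPow es m = ∏ d_p^{v_p(m)}` — the products accumulated by `stripGo`;
* `prefSum ω k = ∑_{m ≤ k} a_ω(m)/m` (`a_ω = complMul ω`) — the snapshots;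
  `c_r(1) = prefSum (N/r)/r`;
* `Inv N W K M es n Bre Bim Lrev Rsum hn hd` — the invariant of the main loop `mainGo` after
  `j = 1, …, n`: `Bre + i Bim = M ∑_{j ≤ n, S-smooth} a_ω(j)/j`; `Lrev` has length `min n K` with
  `i`-th entry `M · prefSum (min n K − i)`; `Rsum ≤ W M ∑_{r ∈ T, r ≤ n} |c_r(1)|`; `hd > 0`; and
  `M |c_r(1)| < hn/hd` for every free prime `r ≤ n` (`T = freePrimes N S`).

## References

* [PlattTrudgian2016] D. J. Platt, T. S. Trudgian, LMS J. Comput. Math. 19 (2016), §2.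
-/

noncomputable section

namespace Literature.Barriers.RiemannHypothesis.TuranCheck

open Literature.Barriers.RiemannHypothesis Complex

/-! ### Validity of a certificate -/

/-- The validity predicate used by the soundness proofs. [folklore] -/
structure Valid (es : List (ℕ × ℤ × ℤ × ℕ)) : Prop where
  prime : ∀ e ∈ es, e.1.Prime
  den_pos : ∀ e ∈ es, 0 < e.2.2.2
  pyth : ∀ e ∈ es, e.2.1 * e.2.1 + e.2.2.1 * e.2.2.1 = (e.2.2.2 : ℤ) * e.2.2.2
  pairwise : (es.map (·.1)).Pairwise (· < ·)

/-! ### Phases and bookkeeping products -/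

/-- The phase function of the certificate: `ω(p) = (x + iy)/d` for the entry with key `p`
(`1` if `p` is not a key). [folklore] -/
noncomputable def phaseOf : List (ℕ × ℤ × ℤ × ℕ) → ℕ → ℂ
  | [], _ => 1
  | (q, x, y, d) :: es, p => if p = q then ((x : ℂ) + (y : ℂ) * I) / (d : ℂ) else phaseOf es p

/-- `∏ p^{v_p(m)}` over the keys. [folklore] -/
def keyPow (es : List (ℕ × ℤ × ℤ × ℕ)) (m : ℕ) : ℕ :=
  (es.map fun e ↦ e.1 ^ m.factorization e.1).prod

/-- `∏ (x_p + i y_p)^{v_p(m)}` over the entries. [folklore] -/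
noncomputable def phasePow (es : List (ℕ × ℤ × ℤ × ℕ)) (m : ℕ) : ℂ :=
  (es.map fun e ↦ (((e.2.1 : ℤ) : ℂ) + ((e.2.2.1 : ℤ) : ℂ) * I) ^ m.factorization e.1).prod

/-- `∏ d_p^{v_p(m)}` over the entries. [folklore] -/
def denPow (es : List (ℕ × ℤ × ℤ × ℕ)) (m : ℕ) : ℕ :=
  (es.map fun e ↦ e.2.2.2 ^ m.factorization e.1).prod

/-! ### Prefix sums, keys, and the loop invariant -/

/-- `L(k) = ∑_{m ≤ k} a_ω(m)/m`. [folklore] -/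
def prefSum (ω : ℕ → ℂ) (k : ℕ) : ℂ :=
  ∑ m ∈ Finset.Icc 1 k, complMul ω m * (m : ℂ)⁻¹

/-- The set of keys of the certificate. [folklore] -/
abbrev keySet (es : List (ℕ × ℤ × ℤ × ℕ)) : Finset ℕ := (es.map (·.1)).toFinset

/-- The invariant of the main loop after `j = 1, …, n` (see the module docstring), for the state
`(Bre, Bim, Lrev, Rsum, hn, hd)`. [folklore] -/
structure Inv (N W K M : ℕ) (es : List (ℕ × ℤ × ℤ × ℕ)) (n : ℕ) (Bre Bim : ℤ)
    (Lrev : List (ℤ × ℤ)) (Rsum hn hd : ℕ) : Prop where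
  hB : (Bre : ℂ) + (Bim : ℂ) * I =
    (M : ℂ) * ∑ j ∈ (Finset.Icc 1 n).filter (fun j ↦ j.primeFactors ⊆ keySet es),
      complMul (phaseOf es) j * (j : ℂ)⁻¹
  hlen : Lrev.length = min n K
  hL : ∀ i : ℕ, i < min n K →
    ((Lrev.getD i (0, 0)).1 : ℂ) + ((Lrev.getD i (0, 0)).2 : ℂ) * I =
      (M : ℂ) * prefSum (phaseOf es) (min n K - i)
  hR : (Rsum : ℝ) ≤ W * M *
    ∑ r ∈ (freePrimes N (keySet es)).filter (· ≤ n), ‖bigCoeff N (phaseOf es) r 1‖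
  hhd : 0 < hd
  hH : ∀ r ∈ freePrimes N (keySet es), r ≤ n →
    (M : ℝ) * ‖bigCoeff N (phaseOf es) r 1‖ < hn / hd

end Literature.Barriers.RiemannHypothesis.TuranCheck
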